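import Summits.HubbardSuperconductivity.HubbardSuperconductivity.Theses.SpNLargeN
import Summits.HubbardSuperconductivity.HubbardSuperconductivity.Theorems.TwTipContinuation.Negative.TipNormalForm

/-!
# Route `SpNLargeN` — the deciding crux `SpnTarget` (stmt-HubbardSuperconductivity-1663) cut along the
# vanishing-regularisation seam: (uniform `t-U-J` floor for `J > 0`) ∧ (endpoint spectral stability) → `SpnTarget`

`SpnTarget` asks for every-ground-state `d_{x²-y²}` pair-field order of the `t-U-J` torus model
`H_L(U,J) = hubbardTorus 2 L 1 U − (J/4) Σ_{x∼y} b†_{xy} b_{xy}` for EVERY `J` in a CLOSED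
segment `[0, J₀]`; its `J = 0` instance is the summit. This module proves, definition-free, that it
follows from two statements NEITHER of which speaks about the pure Hubbard model's order:

* (FLOOR, `J > 0` only) on an open window of repulsions `U ∈ (U₁, U₂)` and at one doping `δ`, for
  every `U` in the window there are `J₀, a > 0` and `k₀` such that every unit sector ground state of
  `H_{2(k+1)}(U,J)`, `J ∈ (0, J₀]`, `k ≥ k₀`, has `(2(k+1))⁻⁴ Re⟨ψ, Δ_d†Δ_d ψ⟩ ≥ a` — the constants
  are UNIFORM in the regularisation `J` (this is where "no first-order endpoint at `J = 0⁺`" lives,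
  stated as a property of the attractive models alone);
* (STABILITY, no order) for every doping and every open window of repulsions there is a `U` in the
  window such that, at every large even side, every unit sector ground state `φ` of the PURE torus
  `hubbardTorus 2 L 1 U` is the limit of unit sector ground states `ψ_n` of `H_L(U, J_n)` along some
  `J_n ↓ 0` (finite-volume spectral faithfulness of the limit `J → 0⁺`: the exchange term does not
  split the `J = 0` ground multiplet; automatic when that multiplet is irreducible under the lattice
  and spin symmetries shared by both models, i.e. barring accidental degeneracy).

`spnTarget_of_pieces`: choose `U` in the window where the endpoint is
stable; for `J ∈ (0, J₀]` the floor is the window floor; at `J = 0` and side `2(k+1)`,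
`k ≥ max k₁ k₂`, write the given ground state as `lim ψ_n`; eventually `J_n ≤ J₀`, so the window
floor gives `F(ψ_n) ≥ a`, and `F(lim ψ_n) ≥ a` because the order functional
`F(φ) = (2(k+1))⁻⁴ Re⟨φ, Δ_d†Δ_d φ⟩` is continuous (`continuous_dWaveOrderFunctional`, a polynomial
in the coordinates of `φ`); the `liminf` along the sequence is then `≥ a > 0`, its coboundedness
being the kinematic ceiling `expect_pairIntensity_le`. The hypotheses are the route items
`TUJWindowFloor` (stmt-HubbardSuperconductivity-19075) and `EndpointStability`
(stmt-HubbardSuperconductivity-19076); `spnTargetOfPieces_proof` closes the glue item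
`SpnTargetOfPieces` (stmt-HubbardSuperconductivity-19084), making `SpnTarget`
(stmt-HubbardSuperconductivity-1663) DERIVED from the two pieces.

Sources: T. Kato, *Perturbation Theory for Linear Operators* (1966/1995), Ch. II §1 and §6
(analytic perturbation of eigenprojections of Hermitian families in finite dimension: the endpoint
ground space contains the limit of the perturbed ground spaces, with equality iff the perturbation
does not split it); H. Tasaki, *Physics and Mathematics of Quantum Many-Body Systems* (2020) §2.1
(finite-volume ground states, variational characterisation); S. Friedli, Y. Velenik, *Statistical
Mechanics of Lattice Systems* (2017) §3.7.2 (long-range order as a `liminf`); D. J. Scalapino,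
Phys. Rep. 250 (1995) 329, §2 eq. (2.4) (the `d`-wave pair-field order functional). No new
definitions.
-/

-- the mandated namespace `Summit.<Summit>.<Problem>.Theorems` repeats `HubbardSuperconductivity`
-- (single-problem summit, D-0017), which the `dupNamespace` linter flags on every declaration
set_option linter.dupNamespace false

namespace Summit.HubbardSuperconductivity.HubbardSuperconductivity.Theorems.SpNLargeN

open Matrix Filter Topology Literature.MathematicalPhysics.QuantumLattice
open Summit.HubbardSuperconductivity.HubbardSuperconductivity.Theses.SpNLargeN
open Summit.HubbardSuperconductivity.TwTipContinuation.Negative (expect_pairIntensity_le)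

/-- **Continuity of the `d`-wave order functional at a fixed side.** For any side `L ≠ 0` and any
real constant `c`, `φ ↦ Re⟨φ, Δ_d†Δ_d φ⟩ / c` is continuous on the finite-dimensional Fock space of
the torus (`expect A φ = star φ ⬝ᵥ (A *ᵥ φ)` is a polynomial in the coordinates of `φ` and their
conjugates). Tasaki (2020) §2.1. [folklore] -/
theorem continuous_dWaveOrderFunctional (L : ℕ) [NeZero L] (c : ℝ) :
    Continuous fun φ : Fock (Orb (FermionTorus 2 L)) =>
      (expect ((pairField dWaveFormFactor L)ᴴ * pairField dWaveFormFactor L) φ).re / c := by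
  unfold expect
  refine Continuous.div_const (Complex.continuous_re.comp ?_) _
  exact (continuous_id.star).dotProduct (continuous_const.matrix_mulVec continuous_id)

/-- **`SpnTarget` from the uniform `t-U-J` window floor and endpoint spectral stability**
(strategist split of stmt-HubbardSuperconductivity-1663; hypotheses = the route items
`TUJWindowFloor` (stmt-HubbardSuperconductivity-19075) and `EndpointStability`
(stmt-HubbardSuperconductivity-19076) by name). Pick `U` in the floor's window at which the
endpoint `J = 0` is spectrally stable; at `J ∈ (0, J₀]` the floor applies directly; at `J = 0` every
ground state of the pure torus of side `2(k+1)`, `k ≥ max k₁ k₂`, is a limit of `t-U-J` ground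
states along `J_n ↓ 0`, eventually `J_n ≤ J₀`, so the floor passes to the limit by continuity of
the order functional (`continuous_dWaveOrderFunctional`, `ge_of_tendsto`); the `liminf` is `≥ a > 0`
by `le_liminf_of_le`, cobounded through the kinematic ceiling `expect_pairIntensity_le`.
Kato (1995) Ch. II §1; Friedli–Velenik (2017) §3.7.2; Scalapino, Phys. Rep. 250 (1995) 329, §2
eq. (2.4). [folklore] -/
theorem spnTarget_of_pieces (hFloor : TUJWindowFloor) (hStab : EndpointStability) :
    SpnTarget := by
  unfold TUJWindowFloor at hFloor
  unfold EndpointStability at hStab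
  obtain ⟨U₁, U₂, δ, hU₁, hU₁₂, hδ, hwin⟩ := hFloor
  obtain ⟨U, hUmem, k₂, hstab⟩ := hStab δ hδ U₁ U₂ hU₁ hU₁₂
  obtain ⟨J₀, a, hJ₀, ha, k₁, hfloor⟩ := hwin U hUmem
  have hU : 0 < U := lt_of_le_of_lt hU₁ hUmem.1
  refine ⟨U, δ, J₀, hU, hδ, hJ₀, ?_⟩
  intro J hJ N ψ hadm
  -- the order functional along the given sequence
  set F : ℕ → ℝ := fun k => (expect ((pairField dWaveFormFactor (2 * (k + 1)))ᴴ *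
      pairField dWaveFormFactor (2 * (k + 1))) (ψ (2 * (k + 1)))).re /
        (((2 * (k + 1) : ℕ) : ℝ) ^ 4) with hF
  -- Step 1: the floor `a` holds eventually along the sequence
  have hev : ∀ᶠ k in atTop, a ≤ F k := by
    refine eventually_atTop.2 ⟨max k₁ k₂, fun k hk => ?_⟩
    obtain ⟨hN, hnorm, hGS⟩ := hadm (2 * (k + 1)) (even_two_mul (k + 1))
    rw [hN] at hGS
    rcases eq_or_lt_of_le hJ.1 with h0 | hpos
    · -- the endpoint `J = 0`: approximate the pure-model ground state by `t-U-J` ground states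
      subst h0
      simp only [zero_div, Complex.ofReal_zero, zero_smul, sub_zero] at hGS
      obtain ⟨Js, ψs, hJpos, hJlim, hGSs, hlim⟩ :=
        hstab k (le_of_max_le_right hk) (ψ (2 * (k + 1))) hnorm hGS
      -- eventually `Js n ≤ J₀`, so the window floor applies to `ψs n`
      have hevn : ∀ᶠ n in atTop, a ≤ (expect ((pairField dWaveFormFactor (2 * (k + 1)))ᴴ *
          pairField dWaveFormFactor (2 * (k + 1))) (ψs n)).re / (((2 * (k + 1) : ℕ) : ℝ) ^ 4) := by
        filter_upwards [hJlim.eventually_lt_const hJ₀] with n hn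
        exact hfloor (Js n) ⟨hJpos n, hn.le⟩ k (le_of_max_le_left hk) (ψs n) (hGSs n).1 (hGSs n).2
      -- continuity of the order functional transports the floor to the limit `ψ (2(k+1))`
      have htend := ((continuous_dWaveOrderFunctional (2 * (k + 1))
        ((((2 * (k + 1) : ℕ) : ℝ) ^ 4))).tendsto (ψ (2 * (k + 1)))).comp hlim
      exact ge_of_tendsto htend hevn
    · exact hfloor J ⟨hpos, hJ.2⟩ k (le_of_max_le_left hk) (ψ (2 * (k + 1))) hnorm hGS
  -- Step 2: the kinematic ceiling makes the `liminf` honest (coboundedness)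
  have hev' : ∀ᶠ k in atTop, F k ≤
      (∑ e ∈ insert 0 unitSteps, ‖((dWaveFormFactor e / Real.sqrt 2 : ℝ) : ℂ)‖ * 2) ^ 2 := by
    refine Eventually.of_forall fun k => ?_
    obtain ⟨-, hnorm, -⟩ := hadm (2 * (k + 1)) (even_two_mul (k + 1))
    have hpos : (0 : ℝ) < (((2 * (k + 1) : ℕ) : ℝ) ^ 4) := by positivity
    simp only [hF]
    rw [div_le_iff₀ hpos]
    exact expect_pairIntensity_le (2 * (k + 1)) (ψ (2 * (k + 1))) hnorm
  exact lt_of_lt_of_le ha (le_liminf_of_le (isCoboundedUnder_ge_of_eventually_le _ hev') hev)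

/-- **The glue item `SpnTargetOfPieces` (stmt-HubbardSuperconductivity-19084).** [folklore] -/
theorem spnTargetOfPieces_proof : SpnTargetOfPieces :=
  fun h₁ h₂ => spnTarget_of_pieces h₁ h₂

end Summit.HubbardSuperconductivity.HubbardSuperconductivity.Theorems.SpNLargeN
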